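import Literature.AlgebraicGeometry.Frobenioids.MonoidFunctors
import Literature.AnabelianGeometry.EtaleTheta.RealificationExtension
import Literature.AnabelianGeometry.EtaleTheta.PerfectionPrimes

/-!
# The universal property of the realification `M^rlf` (general form of [EtTh] Lemma 3.5 (i))

Sources: S. Mochizuki, *The étale theta function …* [MochizukiEtTh2009], Lemma 3.5 (i), PDF pp. 75–76
(printed 301–302): "The inclusion `P ↪ Q` extends uniquely to inclusions `P^pf ↪ Q`, `P^rlf ↪ Q`" for
`ℝ` supporting `Q`; S. Mochizuki, *The geometry of Frobenioids I* [MochizukiFrdI2008], Def. 2.4 (i)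
p. 48 (the realification `M^rlf`) and Prop. 5.3 p. 103 ("the divisor monoid `Φ^rlf`" of a perf-factorial
monoid `Φ` ON A CATEGORY `D` — i.e. `M ↦ M^rlf` applied functorially to the transition maps of `Φ`, a
step used tacitly in print and in [EtTh] Def. 3.6 (i): "`Φ₀^ℝ := Φ₀^rlf` … [cf. Proposition 3.4, (i)]").

The construction of `Discharge/Sec3Lemma35Rlf.lean` / `RealificationExtension.lean` never uses that `P`
is a submonoid of `Q` nor that `P^pf → Q` is injective: for ANY perf-factorial monoid `M`, ANY monoid
`Q` supported by `ℝ` and ANY homomorphism `ι : M^pf → Q` there is a UNIQUE `φ : M^rlf → Q` with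
`φ ∘ (M^pf → M^rlf) = ι` (the between-element construction). This file records that general form
(`RlfUniversal.existsUnique_lift`) — the universal property of `M^pf → M^rlf` among monoids supported
by `ℝ` — together with order reflection when `ι` is an order embedding with group-saturated image
(`RlfUniversal.dvd_of_lift_dvd`), and derives the FUNCTORIALITY of `M ↦ M^rlf`
(`RlfUniversal.existsUnique_map`, `map_id`, `map_comp`): a homomorphism `f : M → N` of perf-factorial
monoids induces a unique `M^rlf → N^rlf` over `f^pf`, provided `ℝ` supports `N^rlf` ([FrdI] Def. 2.4
(i)–(ii): "`M^rlf` [is] also perf-factorial", its primary components are the `ℝ`-monoprime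
`M^rlf_𝔭`; that hypothesis is the tree's named facts `RealificationIsPerfFactorial` & co., seat
abc-iut-L1-d2). Proof-only (no definitions). Seat abc-iut-L2-d2 (cell abc-iut; generalisation of node
EtTh:Lem3.5 for the merge adapters of [EtTh] Def. 3.6 / [FrdI] Prop. 5.3).
-/

namespace Literature.AnabelianGeometry.EtaleTheta

namespace RlfUniversal

open Literature.AlgebraicGeometry.Frobenioids NNReal Function Lemma35

universe u v

variable {Q : Type u} [CommMonoid Q]

/-! ### The between-element construction for an arbitrary perf-factorial source -/

section Construction

variable {M : Type v} [CommMonoid M] (hP : IsPerfFactorial M)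

/-- Uniqueness of an element of `Q` squeezed between `ι({a·a' | a ≤ x, a' ≤ y})` and
`ι({b·b' | x ≤ b, y ≤ b'})` (`a, a', b, b' ∈ P^pf`; `x, y ∈ P^rlf`): the two families come within
`n`-th roots of the product of gauges of `x` and `y`. [cite: MochizukiEtTh2009, Lem 3.5 p.76] -/
private theorem between₂_unique (hb : ∀ 𝔮 : Primes (Perfection M), IsMonoprime (PfAt M 𝔮)) (ι : Perfection M →* Q)
    (hR : Supports Q MonoidType.R) (x y : hP.Rlf) {q q' : Q}
    (hq : (∀ a a' : Perfection M, hP.toRealification a ∣ x → hP.toRealification a' ∣ y → ι (a * a') ∣ q) ∧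
      ∀ b b' : Perfection M, x ∣ hP.toRealification b → y ∣ hP.toRealification b' → q ∣ ι (b * b'))
    (hq' : (∀ a a' : Perfection M, hP.toRealification a ∣ x → hP.toRealification a' ∣ y → ι (a * a') ∣ q') ∧
      ∀ b b' : Perfection M, x ∣ hP.toRealification b → y ∣ hP.toRealification b' → q' ∣ ι (b * b')) :
    q = q' := by
  obtain ⟨bx, -, hgx⟩ := RlfCoord.exists_gauge hP hb x
  obtain ⟨by_, -, hgy⟩ := RlfCoord.exists_gauge hP hb y
  let L : Set Q := {l | ∃ a a' : Perfection M,
    hP.toRealification a ∣ x ∧ hP.toRealification a' ∣ y ∧ ι (a * a') = l}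
  let U : Set Q := {w | ∃ b b' : Perfection M,
    x ∣ hP.toRealification b ∧ y ∣ hP.toRealification b' ∧ ι (b * b') = w}
  have hgap : ∀ n : ℕ+, ∃ l ∈ L, ∃ e : Q, e ^ (n : ℕ) = ι (bx * by_) ∧ l * e ∈ U := by
    intro n
    obtain ⟨a, ha, hax⟩ := hgx n
    obtain ⟨a', ha', hay⟩ := hgy n
    refine ⟨ι (a * a'), ⟨a, a', ha, ha', rfl⟩,
      ι (isPerfect_perfection.root n bx * isPerfect_perfection.root n by_), ?_, ?_⟩
    · rw [← map_pow, mul_pow, IsPerfect.root_pow, IsPerfect.root_pow]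
    · refine ⟨a * isPerfect_perfection.root n bx, a' * isPerfect_perfection.root n by_, hax, hay, ?_⟩
      rw [← map_mul]
      congr 1
      simp only [mul_assoc, mul_left_comm]
  have mk : ∀ {t : Q},
      ((∀ a a' : Perfection M, hP.toRealification a ∣ x → hP.toRealification a' ∣ y → ι (a * a') ∣ t) ∧
        ∀ b b' : Perfection M, x ∣ hP.toRealification b → y ∣ hP.toRealification b' → t ∣ ι (b * b')) →
      (∀ l ∈ L, l ∣ t) ∧ ∀ w ∈ U, t ∣ w := by
    intro t ht
    constructor
    · rintro _ ⟨a, a', ha, ha', rfl⟩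
      exact ht.1 a a' ha ha'
    · rintro _ ⟨b, b', hb1, hb2, rfl⟩
      exact ht.2 b b' hb1 hb2
  exact between_unique hR hgap (mk hq) (mk hq')

/-- Uniqueness of an element of `Q` squeezed between `ι({a | a ≤ x})` and `ι({b | x ≤ b})`.
[cite: MochizukiEtTh2009, Lem 3.5 p.76] -/
private theorem between_point_unique (hb : ∀ 𝔮 : Primes (Perfection M), IsMonoprime (PfAt M 𝔮)) (ι : Perfection M →* Q)
    (hR : Supports Q MonoidType.R) (x : hP.Rlf) {q q' : Q}
    (hq : (∀ a : Perfection M, hP.toRealification a ∣ x → ι a ∣ q) ∧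
      ∀ b : Perfection M, x ∣ hP.toRealification b → q ∣ ι b)
    (hq' : (∀ a : Perfection M, hP.toRealification a ∣ x → ι a ∣ q') ∧
      ∀ b : Perfection M, x ∣ hP.toRealification b → q' ∣ ι b) :
    q = q' := by
  have lift : ∀ {t : Q}, ((∀ a : Perfection M, hP.toRealification a ∣ x → ι a ∣ t) ∧
      ∀ b : Perfection M, x ∣ hP.toRealification b → t ∣ ι b) →
      ((∀ a a' : Perfection M, hP.toRealification a ∣ x → hP.toRealification a' ∣ 1 → ι (a * a') ∣ t) ∧
        ∀ b b' : Perfection M, x ∣ hP.toRealification b → (1 : hP.Rlf) ∣ hP.toRealification b' →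
          t ∣ ι (b * b')) := by
    intro t ht
    constructor
    · intro a a' ha ha'
      apply ht.1
      rw [map_mul]
      simpa using mul_dvd_mul ha ha'
    · intro b b' hb1 _
      rw [map_mul]
      exact (ht.2 b hb1).trans (dvd_mul_right _ _)
  exact between₂_unique hP hb ι hR x 1 (lift hq) (lift hq')

/-- Existence of an element of `Q` squeezed between `ι({a | a ≤ x})` and `ι({b | x ≤ b})` (the value
`φ(x)`; "this sum converges", p. 75). [cite: MochizukiEtTh2009, Lem 3.5 p.75] -/
private theorem between_point_exists (hb : ∀ 𝔮 : Primes (Perfection M), IsMonoprime (PfAt M 𝔮)) (ι : Perfection M →* Q)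
    (hR : Supports Q MonoidType.R) (x : hP.Rlf) :
    ∃ q : Q, (∀ a : Perfection M, hP.toRealification a ∣ x → ι a ∣ q) ∧
      ∀ b : Perfection M, x ∣ hP.toRealification b → q ∣ ι b := by
  let L : Set Q := {l | ∃ a : Perfection M, hP.toRealification a ∣ x ∧ ι a = l}
  let U : Set Q := {w | ∃ b : Perfection M, x ∣ hP.toRealification b ∧ ι b = w}
  have hLU : ∀ l ∈ L, ∀ w ∈ U, l ∣ w := by
    rintro _ ⟨a, ha, rfl⟩ _ ⟨b, hb', rfl⟩
    exact map_dvd ι ((RlfCoord.toRealification_dvd_iff hP hb a b).mp (ha.trans hb'))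
  have hL : L.Nonempty := ⟨ι 1, 1, by rw [map_one]; exact one_dvd x, rfl⟩
  obtain ⟨b₀, hb₀, -⟩ := RlfCoord.exists_gauge hP hb x
  have hU : U.Nonempty := ⟨ι b₀, b₀, hb₀, rfl⟩
  obtain ⟨s, hs, hs'⟩ := exists_between hR hLU hL hU
  exact ⟨s, fun a ha => hs _ ⟨a, ha, rfl⟩, fun b hb' => hs' _ ⟨b, hb', rfl⟩⟩

/-- **Construction of `φ : P^rlf → Q`.** There is a monoid homomorphism `φ` such that each `φ(x)` is
squeezed between `ι({a ∈ P^pf | a ≤ x})` and `ι({b ∈ P^pf | x ≤ b})` (additivity by uniqueness of the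
squeezed element for products). [cite: MochizukiEtTh2009, Lem 3.5 p.75] -/
private theorem exists_hom_between (hb : ∀ 𝔮 : Primes (Perfection M), IsMonoprime (PfAt M 𝔮)) (ι : Perfection M →* Q)
    (hR : Supports Q MonoidType.R) :
    ∃ φ : hP.Rlf →* Q, ∀ x : hP.Rlf, (∀ a : Perfection M, hP.toRealification a ∣ x → ι a ∣ φ x) ∧
      ∀ b : Perfection M, x ∣ hP.toRealification b → φ x ∣ ι b := by
  choose Φ hΦ using between_point_exists hP hb ι hR
  refine ⟨{ toFun := Φ, map_one' := ?_, map_mul' := fun x y => ?_ }, hΦ⟩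
  · apply between_point_unique hP hb ι hR 1 (hΦ 1)
    constructor
    · intro a ha
      rw [← map_one hP.toRealification, RlfCoord.toRealification_dvd_iff hP hb] at ha
      rw [← map_one ι]
      exact map_dvd ι ha
    · intro b _
      exact one_dvd _
  · apply between₂_unique hP hb ι hR x y
    · constructor
      · intro a a' ha ha'
        apply (hΦ (x * y)).1
        rw [map_mul]
        exact mul_dvd_mul ha ha'
      · intro b b' hb1 hb2
        apply (hΦ (x * y)).2
        rw [map_mul]
        exact mul_dvd_mul hb1 hb2
    · constructor
      · intro a a' ha ha'
        rw [map_mul]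
        exact mul_dvd_mul ((hΦ x).1 a ha) ((hΦ y).1 a' ha')
      · intro b b' hb1 hb2
        rw [map_mul]
        exact mul_dvd_mul ((hΦ x).2 b hb1) ((hΦ y).2 b' hb2)

/-- A homomorphism `ψ : P^rlf → Q` extending `ι : P^pf → Q` is squeezed: `ι a ≤ ψ x ≤ ι b` whenever
`a ≤ x ≤ b`. [cite: MochizukiEtTh2009, Lem 3.5 p.76] -/
private theorem between_of_comp_eq (ι : Perfection M →* Q) (ψ : hP.Rlf →* Q)
    (hψ : ψ.comp hP.toRealification = ι) (x : hP.Rlf) :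
    (∀ a : Perfection M, hP.toRealification a ∣ x → ι a ∣ ψ x) ∧
      ∀ b : Perfection M, x ∣ hP.toRealification b → ψ x ∣ ι b := by
  constructor
  · intro a ha
    rw [← hψ]
    exact map_dvd ψ ha
  · intro b hb'
    rw [← hψ]
    exact map_dvd ψ hb'

/-- **Existence of the extension** `P^pf → Q` ↝ `P^rlf → Q`: for every `ι : P^pf → Q` there is
`φ : P^rlf → Q` with `φ ∘ (P^pf → P^rlf) = ι`, provided `ℝ` supports `Q` ("extends … to a homomorphism
of monoids `φ : P^rlf → Q`", pp. 75–76). [cite: MochizukiEtTh2009, Lem 3.5 p.75] -/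
theorem exists_rlf_hom_comp_eq (hb : ∀ 𝔮 : Primes (Perfection M), IsMonoprime (PfAt M 𝔮)) (ι : Perfection M →* Q)
    (hR : Supports Q MonoidType.R) :
    ∃ φ : hP.Rlf →* Q, φ.comp hP.toRealification = ι := by
  obtain ⟨φ, hφ⟩ := exists_hom_between hP hb ι hR
  refine ⟨φ, MonoidHom.ext fun a₀ => ?_⟩
  apply between_point_unique hP hb ι hR (hP.toRealification a₀) (hφ _)
  constructor
  · intro a ha
    exact map_dvd ι ((RlfCoord.toRealification_dvd_iff hP hb a a₀).mp ha)
  · intro b hb'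
    exact map_dvd ι ((RlfCoord.toRealification_dvd_iff hP hb a₀ b).mp hb')

/-- **Uniqueness of the extension**: two homomorphisms `P^rlf → Q` that agree on `P^pf` coincide,
provided `ℝ` supports `Q` ("uniquely characterized by the property that it extends the natural
homomorphism of monoids `P^pf → Q`", p. 76). [cite: MochizukiEtTh2009, Lem 3.5 p.76] -/
theorem rlf_hom_ext (hb : ∀ 𝔮 : Primes (Perfection M), IsMonoprime (PfAt M 𝔮)) (ι : Perfection M →* Q)
    (hR : Supports Q MonoidType.R) (ψ ψ' : hP.Rlf →* Q)
    (hψ : ψ.comp hP.toRealification = ι) (hψ' : ψ'.comp hP.toRealification = ι) : ψ = ψ' :=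
  MonoidHom.ext fun x => between_point_unique hP hb ι hR x
    (between_of_comp_eq hP ι ψ hψ x) (between_of_comp_eq hP ι ψ' hψ' x)

/-- **Order reflection** ("we conclude that `a ≥ b`", p. 76): if `ι : P^pf ↪ Q` is injective with
group-saturated image — the `P^pf` portion of Lemma 3.5 (i), (ii) — then any `ψ : P^rlf → Q` extending
`ι` reflects `≤`: `ψ x ≤ ψ y ⇒ x ≤ y`. [cite: MochizukiEtTh2009, Lem 3.5 p.76] -/
theorem dvd_of_rlf_hom_dvd (hb : ∀ 𝔮 : Primes (Perfection M), IsMonoprime (PfAt M 𝔮)) (ι : Perfection M →* Q)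
    (hιinj : Injective ι)
    (hιsat : IsGroupSaturated (MonoidHom.mrange ι)) (ψ : hP.Rlf →* Q)
    (hψ : ψ.comp hP.toRealification = ι) {x y : hP.Rlf} (h : ψ x ∣ ψ y) : x ∣ y := by
  -- `ι` reflects divisibility, by group-saturation of its image and injectivity
  have hιdvd : ∀ a b : Perfection M, ι a ∣ ι b → a ∣ b := by
    rintro a b ⟨q, hq⟩
    rw [isGroupSaturated_iff'] at hιsat
    have hqmem : q ∈ MonoidHom.mrange ι :=
      hιsat q (ι b) ⟨b, rfl⟩ (ι a) ⟨a, rfl⟩ (by rw [mul_comm]; exact hq.symm)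
    obtain ⟨d, rfl⟩ := MonoidHom.mem_mrange.mp hqmem
    exact ⟨d, hιinj (by rw [map_mul, hq])⟩
  obtain ⟨bx, -, hgx⟩ := RlfCoord.exists_gauge hP hb x
  obtain ⟨by_, -, hgy⟩ := RlfCoord.exists_gauge hP hb y
  apply RlfCoord.dvd_of_forall_root hP hb (C := hP.toRealification (bx * by_))
  intro n
  obtain ⟨a, ha, hax⟩ := hgx n
  obtain ⟨a', ha', hay⟩ := hgy n
  set ex := isPerfect_perfection.root n bx with hex
  set ey := isPerfect_perfection.root n by_ with hey
  refine ⟨hP.toRealification (ex * ey), ?_, ?_⟩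
  · rw [← map_pow, mul_pow, hex, hey, IsPerfect.root_pow, IsPerfect.root_pow]
  · -- `a ≤ a' · ey` in `P^pf`, via `ι` and `ψ`
    have h1 : ι a ∣ ι (a' * ey) := by
      rw [← hψ]
      exact (map_dvd ψ ha).trans (h.trans (map_dvd ψ hay))
    have h2 : hP.toRealification a ∣ y * hP.toRealification ey := by
      have := map_dvd hP.toRealification (hιdvd _ _ h1)
      rw [map_mul] at this
      exact this.trans (mul_dvd_mul_right ha' _)
    calc x ∣ hP.toRealification (a * ex) := hax
      _ = hP.toRealification a * hP.toRealification ex := map_mul _ _ _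
      _ ∣ (y * hP.toRealification ey) * hP.toRealification ex := mul_dvd_mul_right h2 _
      _ = y * hP.toRealification (ex * ey) := by rw [map_mul, mul_assoc, mul_comm (hP.toRealification ey)]

end Construction

/-! ### The universal property of `M^pf → M^rlf` among monoids supported by `ℝ` -/

/-- **Universal property of the realification.** For a perf-factorial monoid `M`, a monoid `Q`
supported by `ℝ` and any homomorphism `ι : M^pf → Q`, there is a UNIQUE homomorphism `φ : M^rlf → Q`
with `φ ∘ (M^pf → M^rlf) = ι` ([EtTh] Lemma 3.5 (i) is the case of the inclusion of a submonoid).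
[cite: MochizukiEtTh2009, Lem 3.5 p.75] -/
theorem existsUnique_lift {M : Type v} [CommMonoid M] (hM : IsPerfFactorial M)
    (hR : Supports Q MonoidType.R) (ι : Perfection M →* Q) :
    ∃! φ : hM.Rlf →* Q, φ.comp hM.toRealification = ι := by
  obtain ⟨φ, hφ⟩ := exists_rlf_hom_comp_eq hM (PerfectionPrimes.isMonoprime_pfAt hM) ι hR
  exact ⟨φ, hφ, fun ψ hψ => rlf_hom_ext hM (PerfectionPrimes.isMonoprime_pfAt hM) ι hR ψ φ hψ hφ⟩

/-- **Order reflection.** If moreover `ι : M^pf → Q` is injective with group-saturated image, the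
extension `φ : M^rlf → Q` reflects `≤` (hence is injective with group-saturated image — as in
`Discharge/Sec3Lemma35Rlf.lean`). [cite: MochizukiEtTh2009, Lem 3.5 p.76] -/
theorem dvd_of_lift_dvd {M : Type v} [CommMonoid M] (hM : IsPerfFactorial M) (ι : Perfection M →* Q)
    (hιinj : Injective ι) (hιsat : IsGroupSaturated (MonoidHom.mrange ι)) (φ : hM.Rlf →* Q)
    (hφ : φ.comp hM.toRealification = ι) {x y : hM.Rlf} (h : φ x ∣ φ y) : x ∣ y :=
  dvd_of_rlf_hom_dvd hM (PerfectionPrimes.isMonoprime_pfAt hM) ι hιinj hιsat φ hφ h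

/-- Injectivity of the extension under the hypotheses of `dvd_of_lift_dvd`. [cite: MochizukiEtTh2009, Lem 3.5 p.76] -/
theorem lift_injective {M : Type v} [CommMonoid M] (hM : IsPerfFactorial M) (ι : Perfection M →* Q)
    (hιinj : Injective ι) (hιsat : IsGroupSaturated (MonoidHom.mrange ι)) (φ : hM.Rlf →* Q)
    (hφ : φ.comp hM.toRealification = ι) : Injective φ := fun _ _ h =>
  RlfCoord.dvd_antisymm hM (PerfectionPrimes.isMonoprime_pfAt hM)
    (dvd_of_lift_dvd hM ι hιinj hιsat φ hφ h.dvd) (dvd_of_lift_dvd hM ι hιinj hιsat φ hφ h.symm.dvd)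

/-! ### Functoriality of `M ↦ M^rlf` ([FrdI] Prop. 5.3: "the divisor monoid `Φ^rlf`") -/

/-- **Functoriality of the realification.** A homomorphism `f : M → N` of perf-factorial monoids
induces a UNIQUE homomorphism `M^rlf → N^rlf` compatible with `f^pf : M^pf → N^pf` and the natural maps,
provided `ℝ` supports `N^rlf` ([FrdI] Def. 2.4 (i)–(ii)); this is what makes `Φ ↦ Φ^rlf` a monoid on
`D` in [FrdI] Prop. 5.3 and `Φ₀^ℝ := Φ₀^rlf` a functor in [EtTh] Def. 3.6 (i).
[cite: MochizukiFrdI2008, Prop. 5.3 p.103] -/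
theorem existsUnique_map {M : Type v} [CommMonoid M] {N : Type v} [CommMonoid N]
    (hM : IsPerfFactorial M) (hN : IsPerfFactorial N) (hRN : Supports hN.Rlf MonoidType.R) (f : M →* N) :
    ∃! F : hM.Rlf →* hN.Rlf, F.comp hM.toRealification = hN.toRealification.comp (Perfection.map f) :=
  existsUnique_lift hM hRN _

/-- Functoriality, identity: the endomorphism of `M^rlf` over `id^pf = id` is the identity.
[cite: MochizukiFrdI2008, Prop. 5.3 p.103] -/
theorem map_id {M : Type v} [CommMonoid M] (hM : IsPerfFactorial M) (hRM : Supports hM.Rlf MonoidType.R)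
    (F : hM.Rlf →* hM.Rlf)
    (hF : F.comp hM.toRealification = hM.toRealification.comp (Perfection.map (MonoidHom.id M))) :
    F = MonoidHom.id _ := by
  apply (existsUnique_map hM hM hRM (MonoidHom.id M)).unique hF
  rw [Perfection.map_id, MonoidHom.comp_id, MonoidHom.id_comp]

/-- Functoriality, composition: the maps over `f^pf`, `g^pf` compose to the map over `(g ∘ f)^pf`.
[cite: MochizukiFrdI2008, Prop. 5.3 p.103] -/
theorem map_comp {M : Type v} [CommMonoid M] {N : Type v} [CommMonoid N] {L : Type v} [CommMonoid L]
    (hM : IsPerfFactorial M) (hN : IsPerfFactorial N) (hL : IsPerfFactorial L)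
    (hRL : Supports hL.Rlf MonoidType.R) (f : M →* N) (g : N →* L)
    (F : hM.Rlf →* hN.Rlf) (hF : F.comp hM.toRealification = hN.toRealification.comp (Perfection.map f))
    (G : hN.Rlf →* hL.Rlf) (hG : G.comp hN.toRealification = hL.toRealification.comp (Perfection.map g))
    (H : hM.Rlf →* hL.Rlf) (hH : H.comp hM.toRealification = hL.toRealification.comp (Perfection.map (g.comp f))) :
    H = G.comp F := by
  apply (existsUnique_map hM hL hRL (g.comp f)).unique hH
  rw [MonoidHom.comp_assoc, hF, ← MonoidHom.comp_assoc, hG, MonoidHom.comp_assoc, ← Perfection.map_comp]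

end RlfUniversal

end Literature.AnabelianGeometry.EtaleTheta
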